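import Summits.HodgeConjecture.HodgeConjecture.Theorems.Ring2AbelianAllAndreSporadicClassesRank
import Summits.HodgeConjecture.HodgeConjecture.Theorems.Ring2AbelianAllAndreInvariantHomNumHodge
import HarnessLib

/-!
# Ring 2 · sub-cell AbelianAll (ALL ABELIAN VARIETIES), André axis, part XXXI-g — SPORADIC ALGEBRAIC CLASSES AND DIVISION BY THE
# FIBRE CLASS: the fibre-algebraicity clause (FibAlg)_t(q) "a class `x` of the total space with `x ∪ [𝒳_t]` algebraic on `𝒳` restricts
# to an algebraic class of `𝒳_t`" is RIGID — it holds at EVERY fibre or at only COUNTABLY many (no named fact) — while the lift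
# (L)_t(q) is GENERIC (part XXXI-a); their conjunction is part XXIX's point-free division property Div[·,q]; hence, granted Verdier,
# **Div[·,q] ⟺ (FibAlg)_t(q) at uncountably many fibres ⟺ at ONE fibre outside a countable set**, and then `(L)_t(q)` at EVERY `t`

HONEST FRAMING (page 1, verbatim): **research route, not a corollary; conditional on HC_CM plus one named
minimal statement.** Cell line: research route conditional on HC_CM; not a corollary; Q11.4-sentence-2 already
refuted in dim ≥ 3. Nothing in this file proves a case of the Hodge conjecture for an abelian variety. `HC_CM` does NOT occur;
`hGT` = Verdier's generic local triviality is a NAMED-FACT BINDER; the reduction item `CMToAbelian` (stmt-HodgeConjecture-16267) is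
NOT closed here; the cell's `B_min` of record (N104) is untouched; NO node is born (the brackets `Div[…]`, `FibAlg[…]` are the
display-only `local notation3` of parts XXIX-c / XXX-c, restated verbatim); nothing is claimed minimal.

## Content (`f : 𝒳 ⟶ S` a compact pencil of abelian `d`-folds; `L_t = j_{t*} j_t^* = · ∪ [𝒳_t]`, independent of `t`, part XXIX-c)

* §1 (fact-free) **`setOf_forall_mem_algebraicClasses_countable_or_forall`**: for ANY set `𝒲` of classes of `H²ᵖ(𝒳(ℂ);ℂ)`, the set of
  fibres at which every member of `𝒲` is algebraic is COUNTABLE or ALL (part XXXI-a's dichotomy, intersected); uncountably many ⟹ all.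
* §2 (fact-free) **RIGIDITY of (FibAlg)**: `fibAlg_countable_or_forall` — `{t | FibAlg_t(q)}` is countable or everything (§1 for
  `𝒲 = L⁻¹ N^{q+1}(𝒳)`, a `t`-free set by `fiberGysin_map_fiberι_eq_of_points`); `forall_fibAlg_of_not_countable`; and
  `forall_fibAlg_of_not_countable_hodge` — `HC` in degree `2q` at uncountably many members ⟹ (FibAlg)_t(q) at EVERY `t`
  (part XXX-e `fibAlg_of_hodgeClassesAlgebraic` + §2), a Verdier-free transport statement.
* §3 [Verdier] **`fibreClassDivisionAt_of_not_countable_fibAlg`**: (FibAlg)_t(q) at uncountably many `t` ⟹ Div[t,q] (at one, hence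
  every, `t`): pick `t₀` outside part XXXI-a's exceptional set with (FibAlg)_{t₀}; then (L)_{t₀} ∧ (FibAlg)_{t₀} = Div[t₀,q] (part XXX-d)
  and Div is point-free (part XXIX-c); **`fibreClassDivisionAt_iff_not_countable_fibAlg_of_verdier`** (Div ⟺ uncountably many FibAlg
  fibres ⟺ all fibres FibAlg, `fibreClassDivisionAt_iff_forall_fibAlg_of_verdier`); **`comap_le_sup_of_not_countable_fibAlg_of_verdier`**:
  then `(L)_t(q)` at EVERY `t` — an ALGEBRAIC-input, Hodge-free, `HC_CM`-free per-pencil criterion for the André-axis `B_min` in degree `2q`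
  which only asks something at a very general member; `exists_countable_fibreClassDivisionAt_iff_fibAlg_of_verdier` (Div ⟺ FibAlg at any
  ONE point off a countable set).

READING (RING2-MAP §AbelianAll (ab-andre-2, gen 23)): the per-fibre clauses of the axis split into GENERIC ones ((L): automatic off a
countable set) and RIGID ones ((FibAlg), "good", (N_p): all fibres or countably many); `Div = (L) ∧ (FibAlg)` is the point-free meeting
point, and (FibAlg) at a very general member — "transport INTO the very general fibre of the classes made algebraic on `𝒳` by the fibre
class" — already forces the lift everywhere. EDGE LABELS: §1–§2 fact-free; §3 K[Verdier]. No `def`, no `sorry`; axioms standard.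

References: Grothendieck1968 (§3, A(X,L)); Kleiman1968AlgebraicCycles (§3 D(X)); Abdulali1994FamiliesAV (Conj. 5.3); CharlesSchnell2014Notes
(Prop. 11.3.11); Verdier1976 (Cor. (5.1)); Andre1996Motifs (§5.1, §6.3); VoisinHodgeII2003 (§3.3.1, §10.2.1).
-/

noncomputable section

set_option linter.dupNamespace false

namespace Summit.HodgeConjecture.HodgeConjecture.Ring2.AbelianAll

open CategoryTheory AlgebraicGeometry
open Literature.AlgebraicGeometry Literature.AlgebraicGeometry.Motives
open Literature.AlgebraicGeometry.HodgeTheory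
open Summit.HodgeConjecture.HodgeConjecture
open Summit.HodgeConjecture.HodgeConjecture.Theses

variable {𝒳 S : SchemeOver ℂ} {d : ℕ} {f : 𝒳 ⟶ S}

/-- (Div) `Div[hf, t, p]` — division by the fibre class at `t` in degree `2p` (part XXIX-c's display-only bracket, restated verbatim):
`L_t⁻¹ N^{p+1}(𝒳) ≤ N^p(𝒳) + ker j_t^*`. [cite: Grothendieck1968, §3 p. 196 (A(X, L))] [cite: Abdulali1994FamiliesAV, Conjecture 5.3 (p. 1130)] -/
local notation3 "Div[" hf ", " t ", " p "]" =>
  Submodule.comap ((fiberGysin hf t p) ∘ₗ (complexBetti.map (fiberι f t) (2 * p)).hom) (algebraicClasses 𝒳 (p + 1)) ≤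
    algebraicClasses 𝒳 p ⊔ LinearMap.ker (complexBetti.map (fiberι f t) (2 * p)).hom

/-- (FibAlg) `FibAlg[hf, t, q]` — "a class whose fibre-class multiple is algebraic on `𝒳` is algebraic on the fibre `𝒳_t`"
(part XXX-c's display-only bracket, restated verbatim): `L_t⁻¹ N^{q+1}(𝒳) ≤ (j_t^*)⁻¹ N^q(X_t)`. [cite: Kleiman1968AlgebraicCycles, §3 (D(X))] -/
local notation3 "FibAlg[" hf ", " t ", " q "]" =>
  Submodule.comap ((fiberGysin hf t q) ∘ₗ (complexBetti.map (fiberι f t) (2 * q)).hom) (algebraicClasses 𝒳 (q + 1)) ≤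
    (algebraicClasses (fiberOver f t) q).comap (complexBetti.map (fiberι f t) (2 * q)).hom

/-! ## §1 A set of test classes is algebraic at countably many fibres, or at all (no named fact) -/

/-- **DICHOTOMY FOR A SET OF TEST CLASSES (fact-free).** For any set `𝒲 ⊆ H²ᵖ(𝒳(ℂ);ℂ)` of classes of the total space of a compact
pencil of abelian varieties, the set of fibres at which EVERY member of `𝒲` is algebraic is COUNTABLE or ALL of `S(ℂ)`: if some member
fails somewhere its algebraicity locus is countable (part XXXI-a `algebraicityLocus_countable_or_forall`) and contains the set in question.
[cite: CharlesSchnell2014Notes, Prop. 11.3.11 (proof)] -/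
theorem setOf_forall_mem_algebraicClasses_countable_or_forall (hf : IsCompactAbelianPencil f d) (p : ℕ)
    (𝒲 : Set (complexBetti 𝒳 (2 * p))) :
    {t : ComplexPoints S | ∀ W ∈ 𝒲, complexBetti.map (fiberι f t) (2 * p) W ∈ algebraicClasses (fiberOver f t) p}.Countable ∨
      ∀ (t : ComplexPoints S), ∀ W ∈ 𝒲, complexBetti.map (fiberι f t) (2 * p) W ∈ algebraicClasses (fiberOver f t) p := by
  by_cases hall : ∀ (t : ComplexPoints S), ∀ W ∈ 𝒲, complexBetti.map (fiberι f t) (2 * p) W ∈ algebraicClasses (fiberOver f t) p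
  · exact Or.inr hall
  · push Not at hall
    obtain ⟨t₁, W, hW, ht₁⟩ := hall
    refine Or.inl ?_
    rcases algebraicityLocus_countable_or_forall hf.isSmoothProjective_base
      (IsQuasiProjectiveOver.of_isProjectiveOver hf.isSmoothProjective_total.isProjectiveOver)
      hf.isSmoothProjectiveFamily W with hc | hforall
    · exact hc.mono fun t ht ↦ ht W hW
    · exact absurd (hforall t₁) ht₁

/-- Uncountably many fibres at which every member of `𝒲` is algebraic ⟹ every fibre (fact-free). [cite: CharlesSchnell2014Notes, Prop. 11.3.11 (proof)] -/
theorem forall_mem_algebraicClasses_of_not_countable_setOf (hf : IsCompactAbelianPencil f d) (p : ℕ)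
    (𝒲 : Set (complexBetti 𝒳 (2 * p)))
    (h : ¬ {t : ComplexPoints S | ∀ W ∈ 𝒲,
      complexBetti.map (fiberι f t) (2 * p) W ∈ algebraicClasses (fiberOver f t) p}.Countable)
    (t : ComplexPoints S) : ∀ W ∈ 𝒲, complexBetti.map (fiberι f t) (2 * p) W ∈ algebraicClasses (fiberOver f t) p :=
  ((setOf_forall_mem_algebraicClasses_countable_or_forall hf p 𝒲).resolve_left h) t

/-! ## §2 (FibAlg) is rigid: every fibre, or countably many (no named fact) -/

/-- **(FibAlg)_t(q) as "every member of a `t`-free set of test classes is algebraic on `𝒳_t`"**: the test set is `L⁻¹ N^{q+1}(𝒳)`,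
`L = L_s` for any `s` (`fiberGysin_map_fiberι_eq_of_points`). [cite: Kleiman1968AlgebraicCycles, §3 (D(X))] -/
theorem fibAlg_iff_forall_mem (hf : IsCompactAbelianPencil f d) (s t : ComplexPoints S) (q : ℕ) :
    FibAlg[hf, t, q] ↔ ∀ W ∈ {x : complexBetti 𝒳 (2 * q) |
        fiberGysin hf s q (complexBetti.map (fiberι f s) (2 * q) x) ∈ algebraicClasses 𝒳 (q + 1)},
      complexBetti.map (fiberι f t) (2 * q) W ∈ algebraicClasses (fiberOver f t) q := by
  refine ⟨fun h W hW ↦ h ?_, fun h x hx ↦ h x ?_⟩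
  · change ((fiberGysin hf t q) ∘ₗ (complexBetti.map (fiberι f t) (2 * q)).hom) W ∈ algebraicClasses 𝒳 (q + 1)
    rw [LinearMap.comp_apply]
    change fiberGysin hf t q (complexBetti.map (fiberι f t) (2 * q) W) ∈ _
    rw [fiberGysin_map_fiberι_eq_of_points hf t s W]
    exact hW
  · have hx' : ((fiberGysin hf t q) ∘ₗ (complexBetti.map (fiberι f t) (2 * q)).hom) x ∈ algebraicClasses 𝒳 (q + 1) := hx
    rw [LinearMap.comp_apply] at hx'
    change fiberGysin hf t q (complexBetti.map (fiberι f t) (2 * q) x) ∈ _ at hx'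
    rw [fiberGysin_map_fiberι_eq_of_points hf t s x] at hx'
    exact hx'

/-- **RIGIDITY OF (FibAlg) (fact-free): on a compact pencil of abelian varieties the set `{t | (FibAlg)_t(q)}` is COUNTABLE or ALL of
`S(ℂ)`.** [cite: CharlesSchnell2014Notes, Prop. 11.3.11 (proof)] [cite: Kleiman1968AlgebraicCycles, §3 (D(X))] -/
theorem fibAlg_countable_or_forall (hf : IsCompactAbelianPencil f d) (q : ℕ) :
    {t : ComplexPoints S | FibAlg[hf, t, q]}.Countable ∨ ∀ t : ComplexPoints S, FibAlg[hf, t, q] := by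
  rcases isEmpty_or_nonempty (ComplexPoints S) with hS | ⟨⟨s⟩⟩
  · exact Or.inr fun t ↦ (IsEmpty.false t).elim
  rcases setOf_forall_mem_algebraicClasses_countable_or_forall hf q
      {x : complexBetti 𝒳 (2 * q) | fiberGysin hf s q (complexBetti.map (fiberι f s) (2 * q) x) ∈ algebraicClasses 𝒳 (q + 1)}
    with hc | hall
  · refine Or.inl (hc.mono fun t ht ↦ ?_)
    exact (fibAlg_iff_forall_mem hf s t q).1 ht
  · exact Or.inr fun t ↦ (fibAlg_iff_forall_mem hf s t q).2 (hall t)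

/-- **(FibAlg) at uncountably many fibres ⟹ at every fibre (fact-free).** [cite: CharlesSchnell2014Notes, Prop. 11.3.11 (proof)] -/
theorem forall_fibAlg_of_not_countable (hf : IsCompactAbelianPencil f d) (q : ℕ)
    (h : ¬ {t : ComplexPoints S | FibAlg[hf, t, q]}.Countable) (t : ComplexPoints S) : FibAlg[hf, t, q] :=
  ((fibAlg_countable_or_forall hf q).resolve_left h) t

/-- **`HC` in degree `2q` at uncountably many members ⟹ (FibAlg)_t(q) at EVERY member — no Verdier, no `HC_CM`** (part XXX-e
`fibAlg_of_hodgeClassesAlgebraic` at the good members + rigidity). [cite: Kleiman1968AlgebraicCycles, §3 (D(X))]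
[cite: CharlesSchnell2014Notes, Prop. 11.3.11 (proof)] -/
theorem forall_fibAlg_of_not_countable_hodge (hf : IsCompactAbelianPencil f d) (q : ℕ)
    (hHC : ¬ {s : ComplexPoints S | ∀ c : complexBetti (fiberOver f s) (2 * q), IsRationalClass c →
      IsOfHodgeType d (fiberOver f s) (2 * q) q q c → c ∈ algebraicClasses (fiberOver f s) q}.Countable)
    (t : ComplexPoints S) : FibAlg[hf, t, q] :=
  forall_fibAlg_of_not_countable hf q (fun hc ↦ hHC (hc.mono fun s hs ↦ fibAlg_of_hodgeClassesAlgebraic hf s q hs)) t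

/-! ## §3 Div ⟺ (FibAlg) at a very general member, granted Verdier; then the lift everywhere -/

/-- **(FibAlg) AT UNCOUNTABLY MANY FIBRES ⟹ Div[t,q] (at any `t`), granted Verdier.** Off part XXXI-a's countable exceptional set the
lift `(L)_{t₀}(q)` holds; the (FibAlg) fibres being uncountably many, one of them, `t₀`, lies off it; `(L)_{t₀} ∧ (FibAlg)_{t₀}` is Div[t₀,q] (part XXX-d), and Div does not depend on the point (part XXIX-c).
[cite: Verdier1976, Cor. (5.1)] [cite: Grothendieck1968, §3 (A(X,L))] [cite: Abdulali1994FamiliesAV, Conjecture 5.3 (p. 1130)] -/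
theorem fibreClassDivisionAt_of_not_countable_fibAlg_of_verdier (hGT : Verdier1976_genericLocalTriviality)
    (hf : IsCompactAbelianPencil f d) (q : ℕ) (h : ¬ {t : ComplexPoints S | FibAlg[hf, t, q]}.Countable)
    (t : ComplexPoints S) : Div[hf, t, q] := by
  obtain ⟨E, hE, hL⟩ := exists_countable_forall_comap_le_sup_of_verdier' hGT hf
  obtain ⟨t₀, ht₀F, ht₀E⟩ : ∃ t₀ : ComplexPoints S, FibAlg[hf, t₀, q] ∧ t₀ ∉ E := by
    by_contra hne
    push Not at hne
    exact h (hE.mono fun s hs ↦ hne s hs)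
  exact (fibreClassDivisionAt_iff_of_points hf t₀ t q).1
    ((fibreClassDivisionAt_iff_comap_le_sup_and_fibAlg hf t₀ q).2 ⟨hL t₀ ht₀E q, ht₀F⟩)

/-- **Div ⟺ (FibAlg) AT UNCOUNTABLY MANY FIBRES, granted Verdier** (⟹ fact-free: Div, point-free, gives (FibAlg) at every fibre,
part XXX-d; and `S(ℂ)` is uncountable). [cite: Verdier1976, Cor. (5.1)] [cite: Grothendieck1968, §3 (A(X,L))] -/
theorem fibreClassDivisionAt_iff_not_countable_fibAlg_of_verdier (hGT : Verdier1976_genericLocalTriviality)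
    (hf : IsCompactAbelianPencil f d) (q : ℕ) (t : ComplexPoints S) :
    Div[hf, t, q] ↔ ¬ {s : ComplexPoints S | FibAlg[hf, s, q]}.Countable :=
  ⟨fun h ↦ not_countable_of_forall_mem_of_curve hf.isSmoothProjective_base t
      (fun s ↦ fibAlg_of_fibreClassDivisionAt hf s q ((fibreClassDivisionAt_iff_of_points hf t s q).1 h)),
    fun h ↦ fibreClassDivisionAt_of_not_countable_fibAlg_of_verdier hGT hf q h t⟩

/-- **Div ⟺ (FibAlg) AT EVERY FIBRE, granted Verdier.** [cite: Verdier1976, Cor. (5.1)] [cite: Grothendieck1968, §3 (A(X,L))] -/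
theorem fibreClassDivisionAt_iff_forall_fibAlg_of_verdier (hGT : Verdier1976_genericLocalTriviality)
    (hf : IsCompactAbelianPencil f d) (q : ℕ) (t : ComplexPoints S) :
    Div[hf, t, q] ↔ ∀ s : ComplexPoints S, FibAlg[hf, s, q] :=
  ⟨fun h s ↦ fibAlg_of_fibreClassDivisionAt hf s q ((fibreClassDivisionAt_iff_of_points hf t s q).1 h),
    fun h ↦ fibreClassDivisionAt_of_not_countable_fibAlg_of_verdier hGT hf q
      (not_countable_of_forall_mem_of_curve hf.isSmoothProjective_base t h) t⟩

/-- **Div ⟺ (FibAlg) AT ONE POINT OFF A COUNTABLE SET, granted Verdier**: there is a countable `E ⊆ S(ℂ)` such that for every `t₀ ∉ E`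
and every `q`, `Div[·,q] ⟺ (FibAlg)_{t₀}(q)`. [cite: Verdier1976, Cor. (5.1)] [cite: Grothendieck1968, §3 (A(X,L))] -/
theorem exists_countable_fibreClassDivisionAt_iff_fibAlg_of_verdier (hGT : Verdier1976_genericLocalTriviality)
    (hf : IsCompactAbelianPencil f d) :
    ∃ E : Set (ComplexPoints S), E.Countable ∧ ∀ t₀ ∉ E, ∀ q : ℕ, (Div[hf, t₀, q] ↔ FibAlg[hf, t₀, q]) := by
  obtain ⟨E, hE, hL⟩ := exists_countable_forall_comap_le_sup_of_verdier' hGT hf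
  refine ⟨E, hE, fun t₀ ht₀ q ↦ ⟨fun h ↦ fibAlg_of_fibreClassDivisionAt hf t₀ q h, fun h ↦ ?_⟩⟩
  exact (fibreClassDivisionAt_iff_comap_le_sup_and_fibAlg hf t₀ q).2 ⟨hL t₀ ht₀ q, h⟩

/-- **(FibAlg) AT UNCOUNTABLY MANY FIBRES ⟹ THE LIFT `(L)_t(q)` AT EVERY FIBRE, granted Verdier** — an ALGEBRAIC-input, Hodge-free,
`HC_CM`-free per-pencil criterion for the André-axis `B_min` in degree `2q` (Div ⟹ (L), part XXIX-c).
[cite: Verdier1976, Cor. (5.1)] [cite: Andre1996Motifs, §5.1 (p. 25) and §6.3 a) (p. 33)] [cite: Abdulali1994FamiliesAV, Conjecture 5.3 (p. 1130)] -/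
theorem comap_le_sup_of_not_countable_fibAlg_of_verdier (hGT : Verdier1976_genericLocalTriviality)
    (hf : IsCompactAbelianPencil f d) (q : ℕ) (h : ¬ {t : ComplexPoints S | FibAlg[hf, t, q]}.Countable)
    (t : ComplexPoints S) :
    (algebraicClasses (fiberOver f t) q).comap (complexBetti.map (fiberι f t) (2 * q)).hom ≤
      algebraicClasses 𝒳 q ⊔ LinearMap.ker (complexBetti.map (fiberι f t) (2 * q)).hom :=
  comap_le_sup_of_fibreClassDivisionAt hf (fibreClassDivisionAt_of_not_countable_fibAlg_of_verdier hGT hf q h t)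

/-- **THE TRICHOTOMY on a compact pencil of abelian varieties, granted Verdier**: in each degree `2q`, EITHER Div[·,q] holds (and then
(FibAlg) and (L) hold at every fibre), OR (FibAlg) holds at only countably many fibres (while (L) still holds off a countable set).
[cite: Verdier1976, Cor. (5.1)] [cite: Kleiman1968AlgebraicCycles, §3 (D(X))] -/
theorem fibreClassDivisionAt_or_fibAlg_countable_of_verdier (hGT : Verdier1976_genericLocalTriviality)
    (hf : IsCompactAbelianPencil f d) (q : ℕ) (t : ComplexPoints S) :
    (Div[hf, t, q] ∧ ∀ s : ComplexPoints S, FibAlg[hf, s, q] ∧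
        (algebraicClasses (fiberOver f s) q).comap (complexBetti.map (fiberι f s) (2 * q)).hom ≤
          algebraicClasses 𝒳 q ⊔ LinearMap.ker (complexBetti.map (fiberι f s) (2 * q)).hom) ∨
      {s : ComplexPoints S | FibAlg[hf, s, q]}.Countable := by
  by_cases h : {s : ComplexPoints S | FibAlg[hf, s, q]}.Countable
  · exact Or.inr h
  · refine Or.inl ⟨fibreClassDivisionAt_of_not_countable_fibAlg_of_verdier hGT hf q h t, fun s ↦ ⟨?_, ?_⟩⟩
    · exact forall_fibAlg_of_not_countable hf q h s
    · exact comap_le_sup_of_not_countable_fibAlg_of_verdier hGT hf q h s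

end Summit.HodgeConjecture.HodgeConjecture.Ring2.AbelianAll

end
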